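import Literature.NumberTheory.EllipticCurves.LocalTorsionGoodReductionProofs
import Literature.NumberTheory.EllipticCurves.TorsionCardinality
import HarnessLib

/-!
# `E(ℚ_p)[p] = 0` from a finite division-polynomial certificate — the `(t0)` binder of Kim's twins
# discharged at ANY prime `p ≥ 3` with a `p`-integral equation, anomalous primes included

`Proofs`-style file (THEOREMS ONLY: no definition, no named fact, no instance; net debt 0), the
anomalous-prime companion of `LocalTorsionGoodReductionProofs` (which discharges the binder at a
good NON-anomalous `p` from `a_p ≢ 1 (mod p)`).  At a good anomalous prime (`a_p ≡ 1 (mod p)`) the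
point-count argument says nothing, and `E(ℚ_p)[p]` may or may not vanish (C.-H. Kim, Amer. J. Math.
148 (2026), Prop. 3.2 = arXiv Prop. 3.2: `E(ℚ_p)[p] ≠ 0 ⇔ ρ̄|_{G_{ℚ_p}}` is split); the decision is
a FINITE computation, and this file turns the computation into the binder.

## The certificate (Silverman, *AEC*, Exercise 3.7 and VII.3.1)

Let `E₀/ℤ` be an integral Weierstrass equation of `E/ℚ` and `p ≥ 3`.  A point `P = (x, y) ∈ E(ℚ_p)`
with `pP = O`:
* either `‖x‖_p > 1`, i.e. `P ∈ E₁(ℚ_p)` — impossible for `P ≠ O`, since `E₁(ℚ_p)` has no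
  `p`-torsion for `p ≥ 3` (AEC VII.3.1 with IV.6.1; tree
  `LocalTorsionMult.eq_zero_of_isInReductionKernel_of_prime_nsmul`);
* or `x ∈ ℤ_p`, and then `ψ_p(x)² = ΨSq_p(x) = 0` (AEC Ex. 3.7(f); tree
  `WeierstrassCurve.zsmul_some_eq_zero_iff_eval_ΨSq`), i.e. `x` is a `ℤ_p`-root of the univariate
  `p`-division polynomial `preΨ'_p ∈ ℤ[X]` of `E₀` (Mathlib `WeierstrassCurve.preΨ'`; `p` odd, so
  `ΨSq_p = (preΨ'_p)²`), hence a root modulo every `p^k`.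
So: **if `preΨ'_p (E₀)` has no zero in `ℤ/p^k` for some `k`, then `E(ℚ_p)[p] = 0`**
(`localTorsion_eq_zero_of_eval_preΨ'_ne_zero`, and in the `(t0)`-binder currency
`natCard_localPTorsion_eq_one_of_eval_preΨ'_ne_zero`).  For the curves met in practice `k = 2`
suffices whenever `E(ℚ_p)[p] = 0` (the `ℤ_p`-distance of the non-rational `p`-torsion abscissae
is `< p⁻¹`), so the per-pair certificate is `p²` evaluations of an integer polynomial — stated for
`p = 5` in closed form (`preΨ'_5 = preΨ₄ · Ψ₂Sq² − Ψ₃³`, `eval_preΨ'_five`) as a `decide`-able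
integer divisibility check (`natCard_localPTorsion_eq_one_of_certificate_five`).

Nothing here is specific to good reduction or to anomalous primes: the theorem holds for every
`p ≥ 3` and every integral equation; it is USEFUL exactly where the cheaper non-anomalous
discharger does not apply.  CONSUMERS: the proof-covered `(t0)` twins of Kim's structure-theorem
facts (`Kim2022_…_of_localTorsionTrivial`, file `KuriharaNumberKimShaLengthLocalTorsionTrivial`),
whose binder `Nat.card {Q ∈ E(ℚ_p) | p • Q = 0} = 1` this file produces from the certificate — so
a Kurihara-number key at an anomalous good prime with `E(ℚ_p)[p] = 0` costs the literal fact's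
binders plus one `decide` (referee A R456.3 (C) / R351.5: the exit «a (t0) row + a discharger of
the twin's (t0) binder at an anomalous p»).  Nothing is booked here; no `Summits/` file is touched.

## References
* J. H. Silverman, *The Arithmetic of Elliptic Curves*, 2nd ed., GTM 106 (2009), Exercise 3.7
  (division polynomials), Prop. VII.3.1 with Thm. IV.6.1 (`E₁` has no `p`-torsion, `p ≥ 3`),
  VII.2 (the reduction kernel `E₁`). [SilvermanAEC2009]
* C.-H. Kim, *The structure of Selmer groups and the Iwasawa main conjecture for elliptic curves*,
  Amer. J. Math. 148 (2026) = arXiv:2203.12159, §3.1.1 and Prop. 3.2 (PDF p. 15). [Kim2022StructureSelmer]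
-/

noncomputable section

open scoped Classical
open Polynomial

namespace Literature.NumberTheory.EllipticCurves

section General

variable (W₀ : WeierstrassCurve ℤ) (p : ℕ) [Fact p.Prime]

/-- The `ℚ_p`-base change of the rational curve of an integral equation `E₀/ℤ` is `E₀` read in `ℚ_p`.
[folklore] -/
private theorem baseChange_map_intCast_rat_eq_map :
    (W₀.map (Int.castRingHom ℚ)).baseChange ℚ_[p] = W₀.map (Int.castRingHom ℚ_[p]) := by
  rw [WeierstrassCurve.baseChange, WeierstrassCurve.map_map]
  exact congrArg W₀.map (RingHom.ext_int _ _)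

/-- The `ℤ_p`-model `E₀ ⊗ ℤ_p` base-changes to `E₀` read in `ℚ_p`. [folklore] -/
private theorem baseChange_map_intCast_padicInt_eq :
    (W₀.map (Int.castRingHom ℤ_[p])).baseChange ℚ_[p] = W₀.map (Int.castRingHom ℚ_[p]) := by
  rw [WeierstrassCurve.baseChange, WeierstrassCurve.map_map]
  exact congrArg W₀.map (RingHom.ext_int _ _)

/-- **`E(ℚ_p)[p] = 0` from a division-polynomial certificate.** `E₀/ℤ` an integral Weierstrass
equation whose rational curve is elliptic, `p ≥ 3` prime, `k : ℕ`; if the univariate `p`-division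
polynomial `preΨ'_p(E₀) ∈ ℤ[X]` has NO zero in `ℤ/p^k`, then every `P ∈ E(ℚ_p)` with `p • P = O`
is `O`.  Proof: a non-zero `P = (x, y)` has either `‖x‖ > 1` — then `P ∈ E₁(ℚ_p)`, which has no
`p`-torsion (AEC VII.3.1) — or `x ∈ ℤ_p` with `ΨSq_p(x) = preΨ'_p(x)² = 0` (AEC Ex. 3.7(f)), whose
reduction mod `p^k` is a zero of `preΨ'_p` in `ℤ/p^k`.
[cite: SilvermanAEC2009, Exercise 3.7(f) and VII.3 Prop. 3.1 (with IV.6 Thm. 6.1)]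
[cite: Kim2022StructureSelmer, Prop. 3.2 (PDF p. 15)] -/
theorem localTorsion_eq_zero_of_eval_preΨ'_ne_zero (hp3 : 3 ≤ p) (k : ℕ)
    (hcert : ∀ z : ZMod (p ^ k), ((W₀.preΨ' p).map (Int.castRingHom (ZMod (p ^ k)))).eval z ≠ 0)
    (V : WeierstrassCurve ℚ_[p]) [V.IsElliptic] (hV : W₀.map (Int.castRingHom ℚ_[p]) = V)
    (P : V.toAffine.Point) (hP : (p : ℤ) • P = 0) : P = 0 := by
  subst hV
  rcases P with _ | ⟨x, y, h⟩
  · rfl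
  · exfalso
    by_cases hx : 1 < ‖x‖
    · -- `P ∈ E₁(ℚ_p)`, which has no `p`-torsion for `p ≥ 3`
      have hker : (W₀.map (Int.castRingHom ℚ_[p])).IsInReductionKernel (.some x y h) :=
        ((W₀.map (Int.castRingHom ℚ_[p])).isInReductionKernel_some h).2 hx
      have hpP : p • (WeierstrassCurve.Affine.Point.some x y h :
          (W₀.map (Int.castRingHom ℚ_[p])).toAffine.Point) = 0 := by
        rw [← natCast_zsmul]; exact hP
      have h0 := LocalTorsionMult.eq_zero_of_isInReductionKernel_of_prime_nsmul p hp3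
        (W₀.map (Int.castRingHom ℤ_[p])) (W₀.map (Int.castRingHom ℚ_[p]))
        (baseChange_map_intCast_padicInt_eq W₀ p) _ hker hpP
      cases h0
    · -- `x ∈ ℤ_p` is a root of `ΨSq_p = (preΨ'_p)²`
      push Not at hx
      have hΨ : ((W₀.map (Int.castRingHom ℚ_[p])).ΨSq (p : ℤ)).eval x = 0 :=
        ((W₀.map (Int.castRingHom ℚ_[p])).zsmul_some_eq_zero_iff_eval_ΨSq h p).mp hP
      have hodd : ¬ Even p := by
        intro he
        have h2 := (Nat.Prime.even_iff (Fact.out : p.Prime)).mp he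
        omega
      have hpre : ((W₀.map (Int.castRingHom ℚ_[p])).preΨ' p).eval x = 0 := by
        rw [WeierstrassCurve.ΨSq_ofNat, if_neg hodd, mul_one, eval_pow] at hΨ
        exact pow_eq_zero_iff two_ne_zero |>.mp hΨ
      -- `preΨ'_p(E₀ ⊗ ℚ_p) = (preΨ'_p(E₀) ⊗ ℤ_p) ⊗ ℚ_p`
      set F₀ : ℤ_[p][X] := (W₀.preΨ' p).map (Int.castRingHom ℤ_[p]) with hF₀
      have hF : (W₀.map (Int.castRingHom ℚ_[p])).preΨ' p = F₀.map (PadicInt.Coe.ringHom (p := p)) := by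
        rw [WeierstrassCurve.map_preΨ', hF₀, Polynomial.map_map]
        exact congrArg (Polynomial.map · (W₀.preΨ' p)) (RingHom.ext_int _ _)
      -- evaluate at the `p`-adic integer `x₀ = x`
      set x₀ : ℤ_[p] := ⟨x, hx⟩ with hx₀
      have hxco : (x₀ : ℚ_[p]) = x := rfl
      have heval : (PadicInt.Coe.ringHom (p := p)) (F₀.eval x₀) = 0 := by
        rw [← Polynomial.eval₂_at_apply, ← Polynomial.eval_map, ← hF]
        simpa [hxco] using hpre
      have heval0 : F₀.eval x₀ = 0 := PadicInt.coe_eq_zero.mp heval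
      -- reduce modulo `p^k`
      have hmod : ((W₀.preΨ' p).map (Int.castRingHom (ZMod (p ^ k)))).eval
          (PadicInt.toZModPow k x₀) = 0 := by
        have e1 : (W₀.preΨ' p).map (Int.castRingHom (ZMod (p ^ k))) =
            F₀.map (PadicInt.toZModPow k) := by
          rw [hF₀, Polynomial.map_map]
          exact congrArg (Polynomial.map · (W₀.preΨ' p)) (RingHom.ext_int _ _).symm
        rw [e1, Polynomial.eval_map, Polynomial.eval₂_at_apply, heval0, map_zero]
      exact hcert _ hmod

/-- **The `(t0)` binder from the certificate**: for `E/ℚ` elliptic with an integral equation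
`E₀/ℤ` (`E₀ ⊗ ℚ = E`), `p ≥ 3`, and `preΨ'_p(E₀)` without zero in `ℤ/p^k`:
`#{Q ∈ E(ℚ_p) : p • Q = O} = 1` — the binder of the proof-covered twins
`Kim2022_…_of_localTorsionTrivial` (spelling of `natCard_localPTorsion_eq_one_iff`).
[cite: SilvermanAEC2009, Exercise 3.7(f) and VII.3 Prop. 3.1 (with IV.6 Thm. 6.1)]
[cite: Kim2022StructureSelmer, Prop. 3.2 (PDF p. 15)] -/
theorem natCard_localPTorsion_eq_one_of_eval_preΨ'_ne_zero (W : WeierstrassCurve ℚ) [W.IsElliptic]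
    (hW : W₀.map (Int.castRingHom ℚ) = W) (hp3 : 3 ≤ p) (k : ℕ)
    (hcert : ∀ z : ZMod (p ^ k), ((W₀.preΨ' p).map (Int.castRingHom (ZMod (p ^ k)))).eval z ≠ 0) :
    Nat.card {Q : (W.baseChange ℚ_[p]).toAffine.Point // (p : ℕ) • Q = 0} = 1 := by
  subst hW
  rw [natCard_localPTorsion_eq_one_iff]
  intro P hP
  exact localTorsion_eq_zero_of_eval_preΨ'_ne_zero W₀ p hp3 k hcert _
    (baseChange_map_intCast_rat_eq_map W₀ p).symm P hP

end General

section Five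

/-- **`preΨ'_5` in closed form**: `preΨ'_5 = preΨ₄ · Ψ₂Sq² − Ψ₃³` (Mathlib's recursion
`preΨ'_odd` at `m = 0`, with `preΨ'_1 = preΨ'_2 = 1`, `preΨ'_3 = Ψ₃`, `preΨ'_4 = preΨ₄`), evaluated
at `x` as an explicit polynomial expression in `x` and `b₂, b₄, b₆, b₈` (AEC Ex. 3.7:
`ψ₅ = ψ₄ψ₂³ − ψ₁ψ₃³`, `ψ₂² = 4x³ + b₂x² + 2b₄x + b₆` on the curve).
[cite: SilvermanAEC2009, Exercise 3.7(a)] -/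
theorem eval_preΨ'_five {R : Type*} [CommRing R] (W : WeierstrassCurve R) (x : R) :
    (W.preΨ' 5).eval x =
      (2 * x ^ 6 + W.b₂ * x ^ 5 + 5 * W.b₄ * x ^ 4 + 10 * W.b₆ * x ^ 3 + 10 * W.b₈ * x ^ 2 +
          (W.b₂ * W.b₈ - W.b₄ * W.b₆) * x + (W.b₄ * W.b₈ - W.b₆ ^ 2)) *
        (4 * x ^ 3 + W.b₂ * x ^ 2 + 2 * W.b₄ * x + W.b₆) ^ 2 -
      (3 * x ^ 4 + W.b₂ * x ^ 3 + 3 * W.b₄ * x ^ 2 + 3 * W.b₆ * x + W.b₈) ^ 3 := by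
  have h := W.preΨ'_odd 0
  norm_num at h
  rw [h]
  simp only [WeierstrassCurve.preΨ₄, WeierstrassCurve.Ψ₂Sq, WeierstrassCurve.Ψ₃, eval_add, eval_sub,
    eval_mul, eval_pow, eval_C, eval_X, eval_ofNat]

/-- **The `(t0)` binder at `p = 5` from a `decide`-able integer certificate.** `E/ℚ` elliptic with
integral equation `E₀/ℤ` (`E₀ ⊗ ℚ = E`), `k : ℕ`; if for every `0 ≤ z < 5^k` the integer
`preΨ'_5(E₀)(z) = (2z⁶ + b₂z⁵ + 5b₄z⁴ + 10b₆z³ + 10b₈z² + (b₂b₈ − b₄b₆)z + (b₄b₈ − b₆²))·(4z³ + b₂z²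
+ 2b₄z + b₆)² − (3z⁴ + b₂z³ + 3b₄z² + 3b₆z + b₈)³` is NOT divisible by `5^k`, then
`#{Q ∈ E(ℚ_5) : 5 • Q = O} = 1`.  (In practice `k = 2`: 25 evaluations.)
[cite: SilvermanAEC2009, Exercise 3.7(f) and VII.3 Prop. 3.1 (with IV.6 Thm. 6.1)]
[cite: Kim2022StructureSelmer, Prop. 3.2 (PDF p. 15)] -/
theorem natCard_localPTorsion_eq_one_of_certificate_five [Fact (Nat.Prime 5)]
    (W : WeierstrassCurve ℚ) [W.IsElliptic] (W₀ : WeierstrassCurve ℤ)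
    (hW : W₀.map (Int.castRingHom ℚ) = W) (k : ℕ)
    (hcert : ∀ z : ℕ, z < 5 ^ k →
      ¬ ((5 ^ k : ℕ) : ℤ) ∣
        (2 * (z : ℤ) ^ 6 + W₀.b₂ * (z : ℤ) ^ 5 + 5 * W₀.b₄ * (z : ℤ) ^ 4 + 10 * W₀.b₆ * (z : ℤ) ^ 3 +
              10 * W₀.b₈ * (z : ℤ) ^ 2 + (W₀.b₂ * W₀.b₈ - W₀.b₄ * W₀.b₆) * (z : ℤ) +
              (W₀.b₄ * W₀.b₈ - W₀.b₆ ^ 2)) *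
            (4 * (z : ℤ) ^ 3 + W₀.b₂ * (z : ℤ) ^ 2 + 2 * W₀.b₄ * (z : ℤ) + W₀.b₆) ^ 2 -
          (3 * (z : ℤ) ^ 4 + W₀.b₂ * (z : ℤ) ^ 3 + 3 * W₀.b₄ * (z : ℤ) ^ 2 + 3 * W₀.b₆ * (z : ℤ) +
              W₀.b₈) ^ 3) :
    Nat.card {Q : (W.baseChange ℚ_[5]).toAffine.Point // (5 : ℕ) • Q = 0} = 1 := by
  refine natCard_localPTorsion_eq_one_of_eval_preΨ'_ne_zero W₀ 5 W hW (by norm_num) k ?_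
  intro zz hzz
  haveI : NeZero (5 ^ k) := ⟨pow_ne_zero _ (by norm_num)⟩
  have hz : ((zz.val : ℤ) : ZMod (5 ^ k)) = zz := by
    rw [Int.cast_natCast, ZMod.natCast_zmod_val]
  rw [← hz, Polynomial.eval_intCast_map, Int.coe_castRingHom, eval_preΨ'_five,
    ZMod.intCast_zmod_eq_zero_iff_dvd] at hzz
  exact hcert zz.val (ZMod.val_lt zz) hzz

end Five

section SevenEleven

/-! ### Closed forms at `p = 7` and `p = 11` (same method; appended) -/

/-- `eval` of `Ψ₂Sq`: `4x³ + b₂x² + 2b₄x + b₆`. [cite: SilvermanAEC2009, Exercise 3.7(a)] -/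
private theorem eval_Ψ₂Sq_explicit {R : Type*} [CommRing R] (W : WeierstrassCurve R) (x : R) :
    W.Ψ₂Sq.eval x = 4 * x ^ 3 + W.b₂ * x ^ 2 + 2 * W.b₄ * x + W.b₆ := by
  simp only [WeierstrassCurve.Ψ₂Sq, eval_add, eval_mul, eval_pow, eval_C, eval_X]

/-- `eval` of `Ψ₃`: `3x⁴ + b₂x³ + 3b₄x² + 3b₆x + b₈`. [cite: SilvermanAEC2009, Exercise 3.7(a)] -/
private theorem eval_Ψ₃_explicit {R : Type*} [CommRing R] (W : WeierstrassCurve R) (x : R) :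
    W.Ψ₃.eval x = 3 * x ^ 4 + W.b₂ * x ^ 3 + 3 * W.b₄ * x ^ 2 + 3 * W.b₆ * x + W.b₈ := by
  simp only [WeierstrassCurve.Ψ₃, eval_add, eval_mul, eval_pow, eval_C, eval_X, eval_ofNat]

/-- `eval` of `preΨ₄`: `2x⁶ + b₂x⁵ + 5b₄x⁴ + 10b₆x³ + 10b₈x² + (b₂b₈ − b₄b₆)x + (b₄b₈ − b₆²)`.
[cite: SilvermanAEC2009, Exercise 3.7(a)] -/
private theorem eval_preΨ₄_explicit {R : Type*} [CommRing R] (W : WeierstrassCurve R) (x : R) :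
    W.preΨ₄.eval x = 2 * x ^ 6 + W.b₂ * x ^ 5 + 5 * W.b₄ * x ^ 4 + 10 * W.b₆ * x ^ 3 + 10 * W.b₈ * x ^ 2 +
          (W.b₂ * W.b₈ - W.b₄ * W.b₆) * x + (W.b₄ * W.b₈ - W.b₆ ^ 2) := by
  simp only [WeierstrassCurve.preΨ₄, eval_add, eval_mul, eval_pow, eval_C, eval_X, eval_ofNat]

/-- **`preΨ'_6` in closed form**: `preΨ'_6 = Ψ₃ · preΨ'_5 − Ψ₃ · preΨ₄²` (Mathlib `preΨ'_even` at
`m = 0`). [cite: SilvermanAEC2009, Exercise 3.7(a)] -/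
theorem eval_preΨ'_six {R : Type*} [CommRing R] (W : WeierstrassCurve R) (x : R) :
    (W.preΨ' 6).eval x =
      ((3 * x ^ 4 + W.b₂ * x ^ 3 + 3 * W.b₄ * x ^ 2 + 3 * W.b₆ * x + W.b₈) * ((2 * x ^ 6 + W.b₂ * x ^ 5 + 5 * W.b₄ * x ^ 4 + 10 * W.b₆ * x ^ 3 + 10 * W.b₈ * x ^ 2 +
          (W.b₂ * W.b₈ - W.b₄ * W.b₆) * x + (W.b₄ * W.b₈ - W.b₆ ^ 2)) *
        (4 * x ^ 3 + W.b₂ * x ^ 2 + 2 * W.b₄ * x + W.b₆) ^ 2 -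
      (3 * x ^ 4 + W.b₂ * x ^ 3 + 3 * W.b₄ * x ^ 2 + 3 * W.b₆ * x + W.b₈) ^ 3) -
      (3 * x ^ 4 + W.b₂ * x ^ 3 + 3 * W.b₄ * x ^ 2 + 3 * W.b₆ * x + W.b₈) * (2 * x ^ 6 + W.b₂ * x ^ 5 + 5 * W.b₄ * x ^ 4 + 10 * W.b₆ * x ^ 3 + 10 * W.b₈ * x ^ 2 +
          (W.b₂ * W.b₈ - W.b₄ * W.b₆) * x + (W.b₄ * W.b₈ - W.b₆ ^ 2)) ^ 2) := by
  have h := W.preΨ'_even 0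
  norm_num at h
  rw [h]
  simp only [eval_sub, eval_mul, eval_pow, eval_preΨ'_five, eval_Ψ₃_explicit, eval_preΨ₄_explicit]

/-- **`preΨ'_7` in closed form**: `preΨ'_7 = preΨ'_5 · Ψ₃³ − preΨ₄³ · Ψ₂Sq²` (Mathlib `preΨ'_odd` at
`m = 1`). [cite: SilvermanAEC2009, Exercise 3.7(a)] -/
theorem eval_preΨ'_seven {R : Type*} [CommRing R] (W : WeierstrassCurve R) (x : R) :
    (W.preΨ' 7).eval x =
      (((2 * x ^ 6 + W.b₂ * x ^ 5 + 5 * W.b₄ * x ^ 4 + 10 * W.b₆ * x ^ 3 + 10 * W.b₈ * x ^ 2 +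
          (W.b₂ * W.b₈ - W.b₄ * W.b₆) * x + (W.b₄ * W.b₈ - W.b₆ ^ 2)) *
        (4 * x ^ 3 + W.b₂ * x ^ 2 + 2 * W.b₄ * x + W.b₆) ^ 2 -
      (3 * x ^ 4 + W.b₂ * x ^ 3 + 3 * W.b₄ * x ^ 2 + 3 * W.b₆ * x + W.b₈) ^ 3) * (3 * x ^ 4 + W.b₂ * x ^ 3 + 3 * W.b₄ * x ^ 2 + 3 * W.b₆ * x + W.b₈) ^ 3 -
      (2 * x ^ 6 + W.b₂ * x ^ 5 + 5 * W.b₄ * x ^ 4 + 10 * W.b₆ * x ^ 3 + 10 * W.b₈ * x ^ 2 +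
          (W.b₂ * W.b₈ - W.b₄ * W.b₆) * x + (W.b₄ * W.b₈ - W.b₆ ^ 2)) ^ 3 * (4 * x ^ 3 + W.b₂ * x ^ 2 + 2 * W.b₄ * x + W.b₆) ^ 2) := by
  have h := W.preΨ'_odd 1
  norm_num at h
  rw [h]
  simp only [eval_sub, eval_mul, eval_pow, eval_preΨ'_five, eval_Ψ₃_explicit, eval_preΨ₄_explicit, eval_Ψ₂Sq_explicit]

/-- **`preΨ'_11` in closed form**: `preΨ'_11 = preΨ'_7 · preΨ'_5³ − preΨ₄ · preΨ'_6³ · Ψ₂Sq²`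
(Mathlib `preΨ'_odd` at `m = 3`). [cite: SilvermanAEC2009, Exercise 3.7(a)] -/
theorem eval_preΨ'_eleven {R : Type*} [CommRing R] (W : WeierstrassCurve R) (x : R) :
    (W.preΨ' 11).eval x =
      ((((2 * x ^ 6 + W.b₂ * x ^ 5 + 5 * W.b₄ * x ^ 4 + 10 * W.b₆ * x ^ 3 + 10 * W.b₈ * x ^ 2 +
          (W.b₂ * W.b₈ - W.b₄ * W.b₆) * x + (W.b₄ * W.b₈ - W.b₆ ^ 2)) *
        (4 * x ^ 3 + W.b₂ * x ^ 2 + 2 * W.b₄ * x + W.b₆) ^ 2 -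
      (3 * x ^ 4 + W.b₂ * x ^ 3 + 3 * W.b₄ * x ^ 2 + 3 * W.b₆ * x + W.b₈) ^ 3) * (3 * x ^ 4 + W.b₂ * x ^ 3 + 3 * W.b₄ * x ^ 2 + 3 * W.b₆ * x + W.b₈) ^ 3 -
      (2 * x ^ 6 + W.b₂ * x ^ 5 + 5 * W.b₄ * x ^ 4 + 10 * W.b₆ * x ^ 3 + 10 * W.b₈ * x ^ 2 +
          (W.b₂ * W.b₈ - W.b₄ * W.b₆) * x + (W.b₄ * W.b₈ - W.b₆ ^ 2)) ^ 3 * (4 * x ^ 3 + W.b₂ * x ^ 2 + 2 * W.b₄ * x + W.b₆) ^ 2) * ((2 * x ^ 6 + W.b₂ * x ^ 5 + 5 * W.b₄ * x ^ 4 + 10 * W.b₆ * x ^ 3 + 10 * W.b₈ * x ^ 2 +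
          (W.b₂ * W.b₈ - W.b₄ * W.b₆) * x + (W.b₄ * W.b₈ - W.b₆ ^ 2)) *
        (4 * x ^ 3 + W.b₂ * x ^ 2 + 2 * W.b₄ * x + W.b₆) ^ 2 -
      (3 * x ^ 4 + W.b₂ * x ^ 3 + 3 * W.b₄ * x ^ 2 + 3 * W.b₆ * x + W.b₈) ^ 3) ^ 3 -
      (2 * x ^ 6 + W.b₂ * x ^ 5 + 5 * W.b₄ * x ^ 4 + 10 * W.b₆ * x ^ 3 + 10 * W.b₈ * x ^ 2 +
          (W.b₂ * W.b₈ - W.b₄ * W.b₆) * x + (W.b₄ * W.b₈ - W.b₆ ^ 2)) * ((3 * x ^ 4 + W.b₂ * x ^ 3 + 3 * W.b₄ * x ^ 2 + 3 * W.b₆ * x + W.b₈) * ((2 * x ^ 6 + W.b₂ * x ^ 5 + 5 * W.b₄ * x ^ 4 + 10 * W.b₆ * x ^ 3 + 10 * W.b₈ * x ^ 2 +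
          (W.b₂ * W.b₈ - W.b₄ * W.b₆) * x + (W.b₄ * W.b₈ - W.b₆ ^ 2)) *
        (4 * x ^ 3 + W.b₂ * x ^ 2 + 2 * W.b₄ * x + W.b₆) ^ 2 -
      (3 * x ^ 4 + W.b₂ * x ^ 3 + 3 * W.b₄ * x ^ 2 + 3 * W.b₆ * x + W.b₈) ^ 3) -
      (3 * x ^ 4 + W.b₂ * x ^ 3 + 3 * W.b₄ * x ^ 2 + 3 * W.b₆ * x + W.b₈) * (2 * x ^ 6 + W.b₂ * x ^ 5 + 5 * W.b₄ * x ^ 4 + 10 * W.b₆ * x ^ 3 + 10 * W.b₈ * x ^ 2 +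
          (W.b₂ * W.b₈ - W.b₄ * W.b₆) * x + (W.b₄ * W.b₈ - W.b₆ ^ 2)) ^ 2) ^ 3 * (4 * x ^ 3 + W.b₂ * x ^ 2 + 2 * W.b₄ * x + W.b₆) ^ 2) := by
  have h := W.preΨ'_odd 3
  norm_num at h
  rw [h]
  simp only [eval_sub, eval_mul, eval_pow, eval_preΨ'_five, eval_preΨ'_six, eval_preΨ'_seven, eval_preΨ₄_explicit,
    eval_Ψ₂Sq_explicit]

/-- **The `(t0)` binder at `p = 7` from a `decide`-able integer certificate** (as
`natCard_localPTorsion_eq_one_of_certificate_five`, with `preΨ'_7 = preΨ'_5·Ψ₃³ − preΨ₄³·Ψ₂Sq²`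
written out in the `b`-invariants of the integral model `E₀`; in practice `k = 2`, 49 residues).
[cite: SilvermanAEC2009, Exercise 3.7(f) and VII.3 Prop. 3.1 (with IV.6 Thm. 6.1)]
[cite: Kim2022StructureSelmer, Prop. 3.2 (PDF p. 15)] -/
theorem natCard_localPTorsion_eq_one_of_certificate_seven [Fact (Nat.Prime 7)]
    (W : WeierstrassCurve ℚ) [W.IsElliptic] (W₀ : WeierstrassCurve ℤ)
    (hW : W₀.map (Int.castRingHom ℚ) = W) (k : ℕ)
    (hcert : ∀ z : ℕ, z < 7 ^ k → ¬ ((7 ^ k : ℕ) : ℤ) ∣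
      (((2 * (z : ℤ) ^ 6 + W₀.b₂ * (z : ℤ) ^ 5 + 5 * W₀.b₄ * (z : ℤ) ^ 4 + 10 * W₀.b₆ * (z : ℤ) ^ 3 + 10 * W₀.b₈ * (z : ℤ) ^ 2 +
          (W₀.b₂ * W₀.b₈ - W₀.b₄ * W₀.b₆) * (z : ℤ) + (W₀.b₄ * W₀.b₈ - W₀.b₆ ^ 2)) *
        (4 * (z : ℤ) ^ 3 + W₀.b₂ * (z : ℤ) ^ 2 + 2 * W₀.b₄ * (z : ℤ) + W₀.b₆) ^ 2 -
      (3 * (z : ℤ) ^ 4 + W₀.b₂ * (z : ℤ) ^ 3 + 3 * W₀.b₄ * (z : ℤ) ^ 2 + 3 * W₀.b₆ * (z : ℤ) + W₀.b₈) ^ 3) * (3 * (z : ℤ) ^ 4 + W₀.b₂ * (z : ℤ) ^ 3 + 3 * W₀.b₄ * (z : ℤ) ^ 2 + 3 * W₀.b₆ * (z : ℤ) + W₀.b₈) ^ 3 -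
      (2 * (z : ℤ) ^ 6 + W₀.b₂ * (z : ℤ) ^ 5 + 5 * W₀.b₄ * (z : ℤ) ^ 4 + 10 * W₀.b₆ * (z : ℤ) ^ 3 + 10 * W₀.b₈ * (z : ℤ) ^ 2 +
          (W₀.b₂ * W₀.b₈ - W₀.b₄ * W₀.b₆) * (z : ℤ) + (W₀.b₄ * W₀.b₈ - W₀.b₆ ^ 2)) ^ 3 * (4 * (z : ℤ) ^ 3 + W₀.b₂ * (z : ℤ) ^ 2 + 2 * W₀.b₄ * (z : ℤ) + W₀.b₆) ^ 2)) :
    Nat.card {Q : (W.baseChange ℚ_[7]).toAffine.Point // (7 : ℕ) • Q = 0} = 1 := by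
  refine natCard_localPTorsion_eq_one_of_eval_preΨ'_ne_zero W₀ 7 W hW (by norm_num) k ?_
  intro zz hzz
  haveI : NeZero (7 ^ k) := ⟨pow_ne_zero _ (by norm_num)⟩
  have hz : ((zz.val : ℤ) : ZMod (7 ^ k)) = zz := by
    rw [Int.cast_natCast, ZMod.natCast_zmod_val]
  rw [← hz, Polynomial.eval_intCast_map, Int.coe_castRingHom, eval_preΨ'_seven,
    ZMod.intCast_zmod_eq_zero_iff_dvd] at hzz
  exact hcert zz.val (ZMod.val_lt zz) hzz

/-- **The `(t0)` binder at `p = 11` from a `decide`-able integer certificate** (`preΨ'_11 =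
preΨ'_7·preΨ'_5³ − preΨ₄·preΨ'_6³·Ψ₂Sq²` written out in the `b`-invariants; in practice `k = 2`,
121 residues). [cite: SilvermanAEC2009, Exercise 3.7(f) and VII.3 Prop. 3.1 (with IV.6 Thm. 6.1)]
[cite: Kim2022StructureSelmer, Prop. 3.2 (PDF p. 15)] -/
theorem natCard_localPTorsion_eq_one_of_certificate_eleven [Fact (Nat.Prime 11)]
    (W : WeierstrassCurve ℚ) [W.IsElliptic] (W₀ : WeierstrassCurve ℤ)
    (hW : W₀.map (Int.castRingHom ℚ) = W) (k : ℕ)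
    (hcert : ∀ z : ℕ, z < 11 ^ k → ¬ ((11 ^ k : ℕ) : ℤ) ∣
      ((((2 * (z : ℤ) ^ 6 + W₀.b₂ * (z : ℤ) ^ 5 + 5 * W₀.b₄ * (z : ℤ) ^ 4 + 10 * W₀.b₆ * (z : ℤ) ^ 3 + 10 * W₀.b₈ * (z : ℤ) ^ 2 +
          (W₀.b₂ * W₀.b₈ - W₀.b₄ * W₀.b₆) * (z : ℤ) + (W₀.b₄ * W₀.b₈ - W₀.b₆ ^ 2)) *
        (4 * (z : ℤ) ^ 3 + W₀.b₂ * (z : ℤ) ^ 2 + 2 * W₀.b₄ * (z : ℤ) + W₀.b₆) ^ 2 -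
      (3 * (z : ℤ) ^ 4 + W₀.b₂ * (z : ℤ) ^ 3 + 3 * W₀.b₄ * (z : ℤ) ^ 2 + 3 * W₀.b₆ * (z : ℤ) + W₀.b₈) ^ 3) * (3 * (z : ℤ) ^ 4 + W₀.b₂ * (z : ℤ) ^ 3 + 3 * W₀.b₄ * (z : ℤ) ^ 2 + 3 * W₀.b₆ * (z : ℤ) + W₀.b₈) ^ 3 -
      (2 * (z : ℤ) ^ 6 + W₀.b₂ * (z : ℤ) ^ 5 + 5 * W₀.b₄ * (z : ℤ) ^ 4 + 10 * W₀.b₆ * (z : ℤ) ^ 3 + 10 * W₀.b₈ * (z : ℤ) ^ 2 +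
          (W₀.b₂ * W₀.b₈ - W₀.b₄ * W₀.b₆) * (z : ℤ) + (W₀.b₄ * W₀.b₈ - W₀.b₆ ^ 2)) ^ 3 * (4 * (z : ℤ) ^ 3 + W₀.b₂ * (z : ℤ) ^ 2 + 2 * W₀.b₄ * (z : ℤ) + W₀.b₆) ^ 2) * ((2 * (z : ℤ) ^ 6 + W₀.b₂ * (z : ℤ) ^ 5 + 5 * W₀.b₄ * (z : ℤ) ^ 4 + 10 * W₀.b₆ * (z : ℤ) ^ 3 + 10 * W₀.b₈ * (z : ℤ) ^ 2 +
          (W₀.b₂ * W₀.b₈ - W₀.b₄ * W₀.b₆) * (z : ℤ) + (W₀.b₄ * W₀.b₈ - W₀.b₆ ^ 2)) *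
        (4 * (z : ℤ) ^ 3 + W₀.b₂ * (z : ℤ) ^ 2 + 2 * W₀.b₄ * (z : ℤ) + W₀.b₆) ^ 2 -
      (3 * (z : ℤ) ^ 4 + W₀.b₂ * (z : ℤ) ^ 3 + 3 * W₀.b₄ * (z : ℤ) ^ 2 + 3 * W₀.b₆ * (z : ℤ) + W₀.b₈) ^ 3) ^ 3 -
      (2 * (z : ℤ) ^ 6 + W₀.b₂ * (z : ℤ) ^ 5 + 5 * W₀.b₄ * (z : ℤ) ^ 4 + 10 * W₀.b₆ * (z : ℤ) ^ 3 + 10 * W₀.b₈ * (z : ℤ) ^ 2 +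
          (W₀.b₂ * W₀.b₈ - W₀.b₄ * W₀.b₆) * (z : ℤ) + (W₀.b₄ * W₀.b₈ - W₀.b₆ ^ 2)) * ((3 * (z : ℤ) ^ 4 + W₀.b₂ * (z : ℤ) ^ 3 + 3 * W₀.b₄ * (z : ℤ) ^ 2 + 3 * W₀.b₆ * (z : ℤ) + W₀.b₈) * ((2 * (z : ℤ) ^ 6 + W₀.b₂ * (z : ℤ) ^ 5 + 5 * W₀.b₄ * (z : ℤ) ^ 4 + 10 * W₀.b₆ * (z : ℤ) ^ 3 + 10 * W₀.b₈ * (z : ℤ) ^ 2 +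
          (W₀.b₂ * W₀.b₈ - W₀.b₄ * W₀.b₆) * (z : ℤ) + (W₀.b₄ * W₀.b₈ - W₀.b₆ ^ 2)) *
        (4 * (z : ℤ) ^ 3 + W₀.b₂ * (z : ℤ) ^ 2 + 2 * W₀.b₄ * (z : ℤ) + W₀.b₆) ^ 2 -
      (3 * (z : ℤ) ^ 4 + W₀.b₂ * (z : ℤ) ^ 3 + 3 * W₀.b₄ * (z : ℤ) ^ 2 + 3 * W₀.b₆ * (z : ℤ) + W₀.b₈) ^ 3) -
      (3 * (z : ℤ) ^ 4 + W₀.b₂ * (z : ℤ) ^ 3 + 3 * W₀.b₄ * (z : ℤ) ^ 2 + 3 * W₀.b₆ * (z : ℤ) + W₀.b₈) * (2 * (z : ℤ) ^ 6 + W₀.b₂ * (z : ℤ) ^ 5 + 5 * W₀.b₄ * (z : ℤ) ^ 4 + 10 * W₀.b₆ * (z : ℤ) ^ 3 + 10 * W₀.b₈ * (z : ℤ) ^ 2 +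
          (W₀.b₂ * W₀.b₈ - W₀.b₄ * W₀.b₆) * (z : ℤ) + (W₀.b₄ * W₀.b₈ - W₀.b₆ ^ 2)) ^ 2) ^ 3 * (4 * (z : ℤ) ^ 3 + W₀.b₂ * (z : ℤ) ^ 2 + 2 * W₀.b₄ * (z : ℤ) + W₀.b₆) ^ 2)) :
    Nat.card {Q : (W.baseChange ℚ_[11]).toAffine.Point // (11 : ℕ) • Q = 0} = 1 := by
  refine natCard_localPTorsion_eq_one_of_eval_preΨ'_ne_zero W₀ 11 W hW (by norm_num) k ?_
  intro zz hzz
  haveI : NeZero (11 ^ k) := ⟨pow_ne_zero _ (by norm_num)⟩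
  have hz : ((zz.val : ℤ) : ZMod (11 ^ k)) = zz := by
    rw [Int.cast_natCast, ZMod.natCast_zmod_val]
  rw [← hz, Polynomial.eval_intCast_map, Int.coe_castRingHom, eval_preΨ'_eleven,
    ZMod.intCast_zmod_eq_zero_iff_dvd] at hzz
  exact hcert zz.val (ZMod.val_lt zz) hzz

end SevenEleven

end Literature.NumberTheory.EllipticCurves
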